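import Summits.QuantumFields.BalabanUV.T4Continuum.Support.ShellMeasureWilsonGaugeInvariant

/-!
# `T4Continuum.ShellMeasureWilsonExterior` — (M1)₀ REALIZED for `G = SU(2)` with a BLOCK-BLIND gauge-invariant
# EXTERIOR FACTOR riding free (exterior Wilson weight, exterior-only co-tests): row S1's theorem with `G·giF`
# (cell `pub-balaban`, sub-cell `t4`, spine estimate NE7c (node U5b); ROUND-2 crew `t4-ne7c-formalise-*`, leaf prover 03,
# companion of row S2 ((MR)₀) of the crew claim table `t4/b2b-balaban-t4-ne7c-p1/LEAVES-NE7c-P1.md`; ADDITIVE — imports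
# row S1's `ShellMeasureWilsonGaugeInvariant` (p207446) only; 0 `def`, 0 sorry)

HONEST FRAMING.  Finite four-torus programme, rung (B)+1 only — NOT infinite volume, NOT a mass gap, NOT the Clay
problem, NOT summit progress; (B), `BetaPertHyp`, (B^μ) not consumed.  NE7c NOT PRINTED, NOT PROVED; «NE7c ⇐ the
named binders» (trigger c3); (M1)₀ realized ≠ NE7c; (M1) for Bałaban's effective measures NOT PRINTED (G-ne7cp1-1).
WHY THIS FILE.  In the realized level-0 slot measure the factors that do not read the block's chart bonds `Λ` — the
Wilson weight of the plaquettes NOT meeting `Λ`, the small-field tests of cubes whose regions do not meet `Λ`, far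
large-field complements — must NOT be dropped under the (MR)₀ mass ratio of row S2 (their conditional mass is not
close to `1` uniformly in the volume); they ride FREE because they are constant along the block contraction of every
exterior section.  Row S1's `slotAntiConcentration_wilson_su2_gaugeInvariant` is stated for the density `giF` alone; this
file re-runs ITS proof (same engine `ShellMeasureHeadlines.slotAntiConcentration_realized_su2_gaugeInvariant`, same
core map, same reach lemma — the proof text of §2 is S1's, adapted) for the density `G · giF` with ANY measurable,
gauge-invariant, `Λ`-BLIND factor `G ≤ 1`, with the SAME constant: in the engine's block weight `R V y` the factor
enters as the constant `G(V[comb := 1])` of the section ((S-i) untouched, (S-ii) multiplied through, finiteness by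
`G ≤ 1`).  §1 supplies the blindness bookkeeping for plaquette factors whose bonds avoid `Λ`.  0 sorry, 0 citations.
HONEST DEPENDENCY (cell): continuum YM on T⁴ ⇐ BetaPertH ∧ nine spine estimates (0/9 proved); BetaPertH ⇐ (D1) ∧ (D4) ∧
CAP+tail; G-an2-4 gates asym, D1 and NE2/3/4.

WHAT IS PROVED (all [folklore]).  §1 `plaqHol_updateFinset_of_avoids` (a plaquette whose four bonds avoid `Λ` does not
see the block section), `plaqSmallOn_updateFinset_of_avoids`, `indicator_plaqSmallOn_updateFinset_of_avoids`,
`wilsonSum_updateFinset_of_avoids` (exterior co-tests and exterior Wilson sums are `Λ`-blind), gauge invariance of both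
(and of products); `exteriorFactor_admissible` packages the concrete exterior factor `1[Q_ext η-small]·e^{−β Σ_{P_ext}}`.  §2 `slotAntiConcentration_wilson_su2_exterior`: row S1's hypotheses +
`G` measurable, gauge invariant, `Λ`-blind, `≤ 1` ⟹
`SlotAntiConcentration ((fieldMeasure P j SU2).withDensity (G · giF lo hi σ β P_w)) (max_{p∈P_u} dist1 U(∂p)) θ ρ (2(n + β·#P_w·8S(8+32S))/(1−δ))`.

WHAT THIS DOES NOT DO.  (MR)₀'s mass ratio (row S2, displayed there); the quadratic-in-`S` improvement of the constant
from exterior smallness; anything at `j ≥ 1`; NE7c NOT proved; 0/9 spine.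
-/

noncomputable section

open NormedSpace Set Function MeasureTheory

namespace Summit.QuantumFields.BalabanUV.T4Continuum.ShellMeasureWilsonExterior

open scoped ENNReal Matrix.Norms.L2Operator
open Literature.MathematicalPhysics.QuantumFieldTheory.Balaban1983to89
open GaugeField (GaugeInvariant)
open T4ShellMeasure (SlotAntiConcentration)
open T4CubePoincare (cube)
open T4CubeChartGnomonic (SU2)
open T4CubeChartExp (expFibreChart expWindowDensity expWindowDensity_congr)
open T4ShellMeasureDet (blockLaw)
open T4TreeGaugeFixing (fixTo measurable_fixTo noClosedLoop_combBonds)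
open T4AxialGaugeFixing (combBonds measurableSet_plaqSmallOn)
open T4AxialGaugeSmallField (boxPlaqs boxBonds)
open ShellMeasureWilsonWords (scale normSum wordExp coreMap_sup coreMap_word interpConst_mono depth_admissible
  normSum_nonneg scale_one)
open ShellMeasureWilsonTrace (wordEval sGen)
open ShellMeasureWilsonBlock (matrixTrace wilsonAction_contract_sub_le wilson_dictionary_specialUnitaryGroup)
open ShellMeasureWilsonRealizedSU2 (M₂ plaqWord coe_plaqHol_eq_wordEval wordEval_plaqWord_smul plaqWord_data
  wilsonU measurable_wilsonU measurable_wilsonSum wilsonSum_chart_smul)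
open ShellMeasureHeadlines (fixTo_updateFinset_of_disjoint slotAntiConcentration_realized_su2_gaugeInvariant)
open ShellMeasureAxialReach (fixTo_comb_eq_one expWindowDensity_eq_one_of_comb)
open ShellMeasureWilsonGaugeInvariant (boxTest giF measurable_giF giF_le_one gaugeInvariant_giF gaugeInvariant_wilsonU
  withDensity_univ_ne_top_of_le_one exists_gens_of_frozen_eq_one frozen_eq_one_of_mem_plaqWord)

/-! ## §1 Block-blind exterior factors -/

/-- two points that agree on membership carry the same indicator of `1`. [folklore] -/
theorem indicator_one_eq_of_iff {α M : Type*} [MulZeroOneClass M] {s : Set α} {a b : α} (h : a ∈ s ↔ b ∈ s) :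
    s.indicator (1 : α → M) a = s.indicator 1 b := by
  by_cases hb : b ∈ s
  · rw [indicator_of_mem hb, indicator_of_mem (h.2 hb)]; rfl
  · rw [indicator_of_notMem hb, indicator_of_notMem (mt h.1 hb)]

section Blind

variable {P : Params} {j : ℕ} {G : Type*} [GaugeGroup G]

/-- a co-test indicator is gauge invariant (`dist1` is a class function). [folklore] -/
theorem gaugeInvariant_indicator_plaqSmallOn (Q : Set (Plaq P j)) (η : ℝ) :
    GaugeInvariant ({W : GaugeField P j G | PlaqSmallOn Q η W}.indicator (1 : GaugeField P j G → ℝ≥0∞)) :=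
  fun g U => indicator_one_eq_of_iff (by
    simp only [mem_setOf_eq, PlaqSmallOn, T4ReTrLipUnitary.plaqHol_gaugeAct, GaugeGroup.dist1_conj])

/-- an exterior Wilson weight is gauge invariant (`reTr` is a class function). [folklore] -/
theorem gaugeInvariant_wilsonWeight (β : ℝ) (Pe : Finset (Plaq P j)) :
    GaugeInvariant fun U : GaugeField P j G =>
      ENNReal.ofReal (Real.exp (-(β * ∑ p ∈ Pe, (1 - reTr (GaugeField.plaqHol U p))))) := by
  intro g U
  simp only [T4ReTrLipUnitary.plaqHol_gaugeAct, GaugeGroup.reTr_conj]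

/-- products of gauge-invariant factors are gauge invariant. [folklore] -/
theorem gaugeInvariant_mul {F₁ F₂ : GaugeField P j G → ℝ≥0∞} (h₁ : GaugeInvariant F₁) (h₂ : GaugeInvariant F₂) :
    GaugeInvariant fun U => F₁ U * F₂ U := fun g U => by
  simp only [h₁ g U, h₂ g U]

variable [DecidableEq (PBond P j)] (Λ : Finset (PBond P j))

/-- a plaquette whose four bonds avoid `Λ` does not see the block section. [folklore] -/
theorem plaqHol_updateFinset_of_avoids {p : Plaq P j}
    (h1 : (⟨p.src, p.μ⟩ : PBond P j) ∉ Λ) (h2 : (⟨p.src.shift p.μ, p.ν⟩ : PBond P j) ∉ Λ)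
    (h3 : (⟨p.src.shift p.ν, p.μ⟩ : PBond P j) ∉ Λ) (h4 : (⟨p.src, p.ν⟩ : PBond P j) ∉ Λ)
    (U : GaugeField P j G) (y : ↥Λ → G) :
    GaugeField.plaqHol (updateFinset U Λ y) p = GaugeField.plaqHol U p := by
  unfold GaugeField.plaqHol
  simp only [updateFinset, h1, h2, h3, h4, dif_neg, not_false_eq_true]

/-- an exterior co-test (region AVOIDING `Λ`: none of the four bonds of any of its plaquettes lies in `Λ`) is
`Λ`-blind. [folklore] -/
theorem plaqSmallOn_updateFinset_of_avoids {Q : Set (Plaq P j)}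
    (hQ : ∀ p ∈ Q, (⟨p.src, p.μ⟩ : PBond P j) ∉ Λ ∧ (⟨p.src.shift p.μ, p.ν⟩ : PBond P j) ∉ Λ ∧
      (⟨p.src.shift p.ν, p.μ⟩ : PBond P j) ∉ Λ ∧ (⟨p.src, p.ν⟩ : PBond P j) ∉ Λ)
    (η : ℝ) (U : GaugeField P j G) (y : ↥Λ → G) :
    PlaqSmallOn Q η (updateFinset U Λ y) ↔ PlaqSmallOn Q η U := by
  refine forall₂_congr fun p hp => ?_
  obtain ⟨h1, h2, h3, h4⟩ := hQ p hp
  rw [plaqHol_updateFinset_of_avoids Λ h1 h2 h3 h4]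

/-- its indicator is `Λ`-blind. [folklore] -/
theorem indicator_plaqSmallOn_updateFinset_of_avoids {Q : Set (Plaq P j)}
    (hQ : ∀ p ∈ Q, (⟨p.src, p.μ⟩ : PBond P j) ∉ Λ ∧ (⟨p.src.shift p.μ, p.ν⟩ : PBond P j) ∉ Λ ∧
      (⟨p.src.shift p.ν, p.μ⟩ : PBond P j) ∉ Λ ∧ (⟨p.src, p.ν⟩ : PBond P j) ∉ Λ)
    (η : ℝ) (U : GaugeField P j G) (y : ↥Λ → G) :
    {W : GaugeField P j G | PlaqSmallOn Q η W}.indicator (1 : GaugeField P j G → ℝ≥0∞) (updateFinset U Λ y) =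
      {W : GaugeField P j G | PlaqSmallOn Q η W}.indicator 1 U :=
  indicator_one_eq_of_iff (plaqSmallOn_updateFinset_of_avoids Λ hQ η U y)

/-- an exterior Wilson sum (plaquettes avoiding `Λ`) is `Λ`-blind. [folklore] -/
theorem wilsonSum_updateFinset_of_avoids {Pe : Finset (Plaq P j)}
    (hPe : ∀ p ∈ Pe, (⟨p.src, p.μ⟩ : PBond P j) ∉ Λ ∧ (⟨p.src.shift p.μ, p.ν⟩ : PBond P j) ∉ Λ ∧
      (⟨p.src.shift p.ν, p.μ⟩ : PBond P j) ∉ Λ ∧ (⟨p.src, p.ν⟩ : PBond P j) ∉ Λ)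
    (U : GaugeField P j G) (y : ↥Λ → G) :
    ∑ p ∈ Pe, (1 - reTr (GaugeField.plaqHol (updateFinset U Λ y) p)) =
      ∑ p ∈ Pe, (1 - reTr (GaugeField.plaqHol U p)) :=
  Finset.sum_congr rfl fun p hp => by
    obtain ⟨h1, h2, h3, h4⟩ := hPe p hp
    rw [plaqHol_updateFinset_of_avoids Λ h1 h2 h3 h4]

end Blind

section Concrete

variable {P : Params} {j : ℕ} [DecidableEq (PBond P j)]

/-- **THE CONCRETE EXTERIOR FACTOR**: an exterior-only co-test region `Q_ext` (any threshold `η`) and exterior Wilson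
plaquettes `P_ext`, both AVOIDING `Λ`, give `G = 1[Q_ext η-small] · e^{−β Σ_{p∈P_ext}(1 − reTr U(∂p))}` — measurable,
gauge invariant, `Λ`-blind, `≤ 1` — the hypotheses `hGm`/`hGi`/`hGb`/`hG1` of §2. [folklore] -/
theorem exteriorFactor_admissible (Λ : Finset (PBond P j)) {Qext : Set (Plaq P j)} {Pext : Finset (Plaq P j)}
    (hQext : ∀ p ∈ Qext, (⟨p.src, p.μ⟩ : PBond P j) ∉ Λ ∧ (⟨p.src.shift p.μ, p.ν⟩ : PBond P j) ∉ Λ ∧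
      (⟨p.src.shift p.ν, p.μ⟩ : PBond P j) ∉ Λ ∧ (⟨p.src, p.ν⟩ : PBond P j) ∉ Λ)
    (hPext : ∀ p ∈ Pext, (⟨p.src, p.μ⟩ : PBond P j) ∉ Λ ∧ (⟨p.src.shift p.μ, p.ν⟩ : PBond P j) ∉ Λ ∧
      (⟨p.src.shift p.ν, p.μ⟩ : PBond P j) ∉ Λ ∧ (⟨p.src, p.ν⟩ : PBond P j) ∉ Λ)
    (η : ℝ) {β : ℝ} (hβ : 0 ≤ β) :
    (Measurable fun U : GaugeField P j SU2 => {W : GaugeField P j SU2 | PlaqSmallOn Qext η W}.indicator 1 U *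
        ENNReal.ofReal (Real.exp (-(β * ∑ p ∈ Pext, (1 - reTr (GaugeField.plaqHol U p)))))) ∧
      (GaugeInvariant fun U : GaugeField P j SU2 => {W : GaugeField P j SU2 | PlaqSmallOn Qext η W}.indicator 1 U *
        ENNReal.ofReal (Real.exp (-(β * ∑ p ∈ Pext, (1 - reTr (GaugeField.plaqHol U p)))))) ∧
      (∀ (U : GaugeField P j SU2) (y : ↥Λ → SU2),
        {W : GaugeField P j SU2 | PlaqSmallOn Qext η W}.indicator (1 : GaugeField P j SU2 → ℝ≥0∞)
            (updateFinset U Λ y) *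
          ENNReal.ofReal (Real.exp (-(β * ∑ p ∈ Pext, (1 - reTr (GaugeField.plaqHol (updateFinset U Λ y) p))))) =
        {W : GaugeField P j SU2 | PlaqSmallOn Qext η W}.indicator 1 U *
          ENNReal.ofReal (Real.exp (-(β * ∑ p ∈ Pext, (1 - reTr (GaugeField.plaqHol U p)))))) ∧
      (∀ U : GaugeField P j SU2, {W : GaugeField P j SU2 | PlaqSmallOn Qext η W}.indicator (1 : GaugeField P j SU2 → ℝ≥0∞) U *
        ENNReal.ofReal (Real.exp (-(β * ∑ p ∈ Pext, (1 - reTr (GaugeField.plaqHol U p))))) ≤ 1) := by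
  refine ⟨?_, gaugeInvariant_mul (gaugeInvariant_indicator_plaqSmallOn Qext η) (gaugeInvariant_wilsonWeight β Pext),
    fun U y => ?_, fun U => ?_⟩
  · exact (measurable_one.indicator (measurableSet_plaqSmallOn Qext η)).mul (ENNReal.measurable_ofReal.comp
      (Real.measurable_exp.comp ((measurable_const.mul (measurable_wilsonSum Pext))).neg))
  · rw [indicator_plaqSmallOn_updateFinset_of_avoids Λ hQext, wilsonSum_updateFinset_of_avoids Λ hPext]
  · refine mul_le_one' (indicator_apply_le' (fun _ => le_rfl) (fun _ => zero_le_one)) ?_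
    rw [ENNReal.ofReal_le_one, Real.exp_le_one_iff, neg_nonpos]
    exact mul_nonneg hβ (ShellMeasureWilsonRealizedSU2.wilsonSum_nonneg Pext U)

end Concrete

/-! ## §2 (M1)₀ realized, gauge-invariant form, with a block-blind exterior factor -/

section Main

variable {P : Params} {j : ℕ} [DecidableEq (PBond P j)]

/-- **(M1)₀ REALIZED FOR `G = SU(2)` WITH A BLOCK-BLIND EXTERIOR FACTOR.**  Row S1's
`ShellMeasureWilsonGaugeInvariant.slotAntiConcentration_wilson_su2_gaugeInvariant` (non-wrapping box `[lo, hi]`, chart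
bonds `Λ` = box bonds off the axial comb with an enumeration `e` of the `n = 3·#Λ` coordinates, window `0 < S ≤ 1/8`,
co-test threshold `σ` with the reach condition `(d−1)·m·σ ≤ 2S/π`, classifier plaquettes `∅ ≠ P_u ⊆ boxPlaqs`, weight
plaquettes `P_w`, `β ≥ 0`, `θ > 0`, `0 ≤ δ < 1`, `0 ≤ ρ ≤ (1−δ)/2`, (SM)₀, (SM)_σ) for the density `G · giF` where
`G` is ANY measurable, gauge-invariant, `Λ`-BLIND (`G(U[Λ := y]) = G(U)`) factor with `G ≤ 1`: SAME conclusion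
`SlotAntiConcentration ((fieldMeasure P j SU2).withDensity (G·giF)) wilsonU θ ρ (2·(n + β·#P_w·8S·(8 + 32S))/(1−δ))`.
The proof is row S1's (author lineage t4-ne7c-p1, gen 26), with the engine's block weight multiplied by the section
constant `G(V[comb := 1])`. [folklore] -/
theorem slotAntiConcentration_wilson_su2_exterior
    {lo hi : Fin P.d → ℤ} {m : ℕ} (hN : ∀ κ, hi κ - lo κ < P.sitesPerDir j) (hm : ∀ κ, hi κ ≤ lo κ + m)
    (Λ : Finset (PBond P j)) (hΛbox : ∀ b ∈ Λ, b ∈ boxBonds lo hi)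
    (hΛcomb : Disjoint Λ (combBonds lo hi))
    (hcov : ∀ b ∈ boxBonds lo hi, b ∉ Λ → b ∈ (combBonds lo hi : Finset (PBond P j)))
    {n : ℕ} (e : ↥Λ × Fin 3 ≃ Fin n)
    {S σ : ℝ} (hS : 0 < S) (hS8 : S ≤ 1 / 8) (hSπ : 3 * S ^ 2 < Real.pi ^ 2) (hσ : 0 < σ)
    (hrad : ((P.d - 1 : ℕ) : ℝ) * m * σ ≤ 2 * S / Real.pi)
    {Pu : Finset (Plaq P j)} (hPu : Pu.Nonempty) (hPubox : ∀ p ∈ Pu, p ∈ boxPlaqs lo hi)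
    (Pw : Finset (Plaq P j)) {β θ δ ρ : ℝ} (hβ : 0 ≤ β) (hθ : 0 < θ) (hδ0 : 0 ≤ δ) (hδ1 : δ < 1) (hρ0 : 0 ≤ ρ)
    (hρ : ρ ≤ (1 - δ) / 2) (hSM : 4 * (8 * S) ^ 2 * Real.exp (2 * (8 * S)) ≤ δ * θ)
    (hSMσ : 4 * (8 * S) ^ 2 * Real.exp (2 * (8 * S)) ≤ δ * σ)
    {Gx : GaugeField P j SU2 → ℝ≥0∞} (hGm : Measurable Gx) (hGi : GaugeInvariant Gx)
    (hGb : ∀ U y, Gx (updateFinset U Λ y) = Gx U) (hG1 : ∀ U, Gx U ≤ 1) :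
    SlotAntiConcentration ((fieldMeasure P j SU2).withDensity fun U => Gx U * giF lo hi σ β Pw U) (wilsonU hPu) θ ρ
      (2 * ((n : ℝ) + β * ∑ _p ∈ Pw, (8 * S) * (8 + 4 * (8 * S))) / (1 - δ)) := by
  -- the depth (as in row S1 / `ShellMeasureWilsonRealizedSU2.slotAntiConcentration_wilson_su2`)
  have h1δ : 0 < 1 - δ := by linarith
  set ρ' := ρ / (1 - δ) with hρ'
  have hρ'0 : 0 ≤ ρ' := div_nonneg hρ0 h1δ.le
  have hρ'2 : ρ' ≤ 1 / 2 := by rw [hρ', div_le_iff₀ h1δ]; linarith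
  set a := -Real.log (1 - ρ') with ha
  have hc0 : 0 < 1 - ρ' := by linarith
  have hc1 : 1 - ρ' ≤ 1 := by linarith
  have hexp : Real.exp (-a) = 1 - ρ' := by rw [ha, neg_neg, Real.exp_log hc0]
  have ha0 : 0 ≤ a := by rw [ha, neg_nonneg]; exact Real.log_nonpos hc0.le hc1
  have ha2 : a ≤ 2 * ρ' := T4ShellMeasureFibre.neg_log_one_sub_le hρ'0 hρ'2
  have h1ca : 1 - (1 - ρ') ≤ a := by
    have h := Real.log_le_sub_one_of_pos hc0
    rw [ha]; linarith
  have hdepth : (1 - ρ') * (1 + δ * (1 - (1 - ρ'))) ≤ 1 - ρ := by rw [hρ']; exact depth_admissible hδ0 hδ1 hρ0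
  have hdepth0 : (1 - ρ') * (1 + δ * (1 - (1 - ρ'))) ≤ 1 - 0 := by linarith
  set Bf := β * ∑ _p ∈ Pw, (8 * S) * (8 + 4 * (8 * S)) with hBf
  have hBf0 : 0 ≤ Bf := by rw [hBf]; exact mul_nonneg hβ (Finset.sum_nonneg fun p _ => by positivity)
  have hNtr : 0 < (matrixTrace (n := Fin 2)).N := ShellMeasureWilsonBlock.matrixTrace_N_pos
  have h8S1 : 8 * S ≤ 1 := by linarith
  -- the tree: the axial comb of the non-wrapping box is loop-free
  have hT := noClosedLoop_combBonds (P := P) (j := j) hN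
  -- the tree-gauged exterior carries unit letters on the comb
  have hWcomb : ∀ (V : GaugeField P j SU2), ∀ b ∈ boxBonds lo hi, b ∉ Λ →
      fixTo (combBonds lo hi) 1 V b = 1 :=
    fun V b hb hbΛ => fixTo_comb_eq_one lo hi V b (hcov b hb hbΛ)
  -- generator lists of the box plaquette words (comb letters drop out)
  have hgen : ∀ (V : GaugeField P j SU2) (x : Fin n → ℝ) (p : Plaq P j), p ∈ boxPlaqs lo hi →
      ∃ l : List M₂, normSum l = sGen (plaqWord Λ e (fixTo (combBonds lo hi) 1 V) x p) ∧
        ∀ c : ℝ, wordEval c (plaqWord Λ e (fixTo (combBonds lo hi) 1 V) x p) = wordExp (scale c l) :=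
    fun V x p hp => exists_gens_of_frozen_eq_one _ (frozen_eq_one_of_mem_plaqWord Λ e (hWcomb V) x hp)
  choose! L hLnorm hLeval using hgen
  -- DICTIONARY: the plaquette variable of the tree-gauged section at the chart point `c • x` is the scaled word
  have hD1 : ∀ (V : GaugeField P j SU2) (x : Fin n → ℝ) (p : Plaq P j), p ∈ boxPlaqs lo hi → ∀ c : ℝ,
      dist1 (GaugeField.plaqHol (fixTo (combBonds lo hi) 1
        (updateFinset V Λ (expFibreChart Λ 1 e (c • x)))) p) = ‖wordExp (scale c (L V x p)) - 1‖ := by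
    intro V x p hp c
    rw [fixTo_updateFinset_of_disjoint hΛcomb, ← (wilson_dictionary_specialUnitaryGroup _).2,
      coe_plaqHol_eq_wordEval, wordEval_plaqWord_smul, hLeval V x p hp c]
  have hD1one : ∀ (V : GaugeField P j SU2) (x : Fin n → ℝ) (p : Plaq P j), p ∈ boxPlaqs lo hi →
      dist1 (GaugeField.plaqHol (fixTo (combBonds lo hi) 1
        (updateFinset V Λ (expFibreChart Λ 1 e x))) p) = ‖wordExp (L V x p) - 1‖ := by
    intro V x p hp
    have h := hD1 V x p hp 1
    rwa [one_smul, scale_one] at h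
  -- sizes on the cube: `normSum (L V x p) ≤ 8S ≤ 1`
  have hLsize : ∀ (V : GaugeField P j SU2) (x : Fin n → ℝ), x ∈ cube n S → ∀ p ∈ boxPlaqs lo hi,
      normSum (L V x p) ≤ 8 * S := by
    intro V x hx p hp
    rw [hLnorm V x p hp]
    exact (plaqWord_data Λ e hS.le (fixTo (combBonds lo hi) 1 V) hx p).2.1
  -- the classifier of the tree-gauged section, read in the chart
  have hU : ∀ (V : GaugeField P j SU2) (x : Fin n → ℝ) (c : ℝ),
      wilsonU hPu (fixTo (combBonds lo hi) 1 (updateFinset V Λ (expFibreChart Λ 1 e (c • x)))) =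
        Pu.sup' hPu fun p => ‖wordExp (scale c (L V x p)) - 1‖ := by
    intro V x c
    unfold wilsonU
    exact Finset.sup'_congr hPu rfl fun p hp => hD1 V x p (hPubox p hp) c
  -- the co-test survives the contraction (core map at threshold σ)
  have hmono : ∀ (V : GaugeField P j SU2) (x : Fin n → ℝ), x ∈ cube n S →
      fixTo (combBonds lo hi) 1 (updateFinset V Λ (expFibreChart Λ 1 e x)) ∈ boxTest lo hi σ →
      fixTo (combBonds lo hi) 1 (updateFinset V Λ (expFibreChart Λ 1 e ((1 - ρ') • x))) ∈ boxTest lo hi σ := by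
    intro V x hx hmem p hp
    rw [hD1 V x p hp (1 - ρ')]
    have h1 : ‖wordExp (L V x p) - 1‖ < σ := by rw [← hD1one V x p hp]; exact hmem p hp
    have hs := hLsize V x hx p hp
    have h := coreMap_word (L V x p) hc0 hc1 (hs.trans h8S1) hσ
      ((interpConst_mono (normSum_nonneg _) hs).trans hSMσ) hdepth0 h1
    simpa using h
  -- the exterior factor is the CONSTANT `Gx (V[comb := 1])` of the section
  have hGsec : ∀ (V : GaugeField P j SU2) (y : ↥Λ → SU2),
      Gx (fixTo (combBonds lo hi) 1 (updateFinset V Λ y)) = Gx (fixTo (combBonds lo hi) 1 V) := by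
    intro V y
    rw [fixTo_updateFinset_of_disjoint hΛcomb, hGb]
  -- row S1's window factorisation and ray-weight loss for `giF`, as named facts of this proof
  have hFw1 : ∀ (V : GaugeField P j SU2) (y : ↥Λ → SU2),
      giF lo hi σ β Pw (fixTo (combBonds lo hi) 1 (updateFinset V Λ y)) =
        ENNReal.ofReal (expWindowDensity Λ (1 : GaugeField P j SU2) S
          (updateFinset (1 : GaugeField P j SU2) Λ y)) *
          giF lo hi σ β Pw (fixTo (combBonds lo hi) 1 (updateFinset V Λ y)) := by
    intro V y
    by_cases hmem : fixTo (combBonds lo hi) 1 (updateFinset V Λ y) ∈ boxTest lo hi σ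
    · have hwin : expWindowDensity Λ 1 S (fixTo (combBonds lo hi) 1 (updateFinset V Λ y)) = 1 :=
        expWindowDensity_eq_one_of_comb _ (S₀ := boxPlaqs lo hi) subset_rfl hmem hσ.le hm
          (fixTo_comb_eq_one lo hi _) hS.le hrad hΛbox
      have hcongr : expWindowDensity Λ 1 S (fixTo (combBonds lo hi) 1 (updateFinset V Λ y)) =
          expWindowDensity Λ (1 : GaugeField P j SU2) S (updateFinset (1 : GaugeField P j SU2) Λ y) :=
        expWindowDensity_congr fun b hb => by
          have hbT : b ∉ combBonds lo hi := Finset.disjoint_left.1 hΛcomb hb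
          simp [fixTo, updateFinset, hb, hbT]
      rw [← hcongr, hwin, ENNReal.ofReal_one, one_mul]
    · have h0 : giF lo hi σ β Pw (fixTo (combBonds lo hi) 1 (updateFinset V Λ y)) = 0 := by
        unfold giF; rw [indicator_of_notMem hmem, zero_mul]
      rw [h0, mul_zero]
  have hden1 : ∀ (V : GaugeField P j SU2) (x : Fin n → ℝ), x ∈ cube n S →
      fixTo (combBonds lo hi) 1 (updateFinset V Λ (expFibreChart Λ 1 e x)) ∈ boxTest lo hi σ →
      giF lo hi σ β Pw (fixTo (combBonds lo hi) 1 (updateFinset V Λ (expFibreChart Λ 1 e x))) ≤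
        ENNReal.ofReal (Real.exp (Bf * a)) *
          giF lo hi σ β Pw (fixTo (combBonds lo hi) 1 (updateFinset V Λ (expFibreChart Λ 1 e
            (Real.exp (-a) • x)))) := by
    intro V x hx hmem1
    rw [hexp]
    have hmem2 := hmono V x hx hmem1
    unfold giF
    rw [indicator_of_mem hmem1, indicator_of_mem hmem2]
    simp only [Pi.one_apply, one_mul]
    rw [fixTo_updateFinset_of_disjoint hΛcomb, fixTo_updateFinset_of_disjoint hΛcomb]
    have h1 : expFibreChart Λ 1 e x = expFibreChart Λ 1 e ((1 : ℝ) • x) := by rw [one_smul]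
    rw [h1, wilsonSum_chart_smul, wilsonSum_chart_smul]
    obtain hdata := fun p => plaqWord_data Λ e hS.le (fixTo (combBonds lo hi) 1 V) hx p
    have hdiff := wilsonAction_contract_sub_le (matrixTrace (n := Fin 2)) hNtr Pw
      (fun p => plaqWord Λ e (fixTo (combBonds lo hi) 1 V) x p)
      (fun p _ => (hdata p).1) (sb := fun _ => 8 * S) (db := fun _ => 8) (fun p _ => (hdata p).2.1)
      (fun p _ => h8S1) (fun p _ => (hdata p).2.2) hβ hc0.le hc1
    rw [← hBf] at hdiff
    have hle : β * ∑ p ∈ Pw, (1 - (matrixTrace (n := Fin 2)).τ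
          (wordEval (1 - ρ') (plaqWord Λ e (fixTo (combBonds lo hi) 1 V) x p)) / (matrixTrace (n := Fin 2)).N) -
        β * ∑ p ∈ Pw, (1 - (matrixTrace (n := Fin 2)).τ
          (wordEval 1 (plaqWord Λ e (fixTo (combBonds lo hi) 1 V) x p)) / (matrixTrace (n := Fin 2)).N) ≤
        Bf * a :=
      hdiff.trans (by nlinarith)
    rw [← ENNReal.ofReal_mul (Real.exp_pos _).le, ← Real.exp_add]
    exact ENNReal.ofReal_le_ofReal (Real.exp_le_exp.2 (by linarith))
  -- THE ENGINE, through the tree gauge, block weight × the section constant `Gx (V[comb := 1])`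
  refine slotAntiConcentration_realized_su2_gaugeInvariant hT 1 Λ e hS hSπ (fun _ => (1 : GaugeField P j SU2))
    (R := fun V y => Gx (fixTo (combBonds lo hi) 1 V) *
      giF lo hi σ β Pw (fixTo (combBonds lo hi) 1 (updateFinset V Λ y)))
    (fun V => ((measurable_giF lo hi σ β Pw).comp ((measurable_fixTo _ 1).comp measurable_updateFinset)).const_mul _)
    (hGm.mul (measurable_giF lo hi σ β Pw)) (gaugeInvariant_mul hGi (gaugeInvariant_giF lo hi σ β Pw))
    (fun V y => ?_)
    (fun V => withDensity_univ_ne_top_of_le_one (blockLaw Λ) fun y => mul_le_one' (hG1 _) (giF_le_one lo hi hβ Pw _))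
    (measurable_wilsonU hPu) (gaugeInvariant_wilsonU hPu) (a := a) (Bf := Bf) hθ.le hρ0 ha0 ?_ ?_ ?_
  · -- window factorisation: S1's, times the section constant
    show Gx (fixTo (combBonds lo hi) 1 (updateFinset V Λ y)) *
        giF lo hi σ β Pw (fixTo (combBonds lo hi) 1 (updateFinset V Λ y)) = _
    rw [hGsec V y]
    conv_rhs => rw [mul_left_comm, ← hFw1 V y]
  · -- the constant
    have hn : (0 : ℝ) ≤ n + Bf := add_nonneg (Nat.cast_nonneg _) hBf0
    calc ((n : ℝ) + Bf) * a ≤ (n + Bf) * (2 * ρ') := mul_le_mul_of_nonneg_left ha2 hn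
      _ = 2 * (n + Bf) / (1 - δ) * ρ := by rw [hρ']; ring
  · -- (S-i)₀ the core map for the classifier (comb letters are unit letters) — S1 verbatim
    intro V x hx _ hux
    rw [hexp, hU]
    have h1 : Pu.sup' hPu (fun p => ‖wordExp (L V x p) - 1‖) < θ := by
      have h := hU V x 1
      rw [one_smul] at h
      rw [h] at hux
      simpa only [scale_one] using hux
    exact coreMap_sup hPu (L V x) hc0 hc1 (fun p hp => (hLsize V x hx p (hPubox p hp)).trans h8S1) hθ
      (fun p hp => (interpConst_mono (normSum_nonneg _) (hLsize V x hx p (hPubox p hp))).trans hSM) hdepth h1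
  · -- (S-ii)₀: S1's ray-weight loss, multiplied by the section constant
    intro V x hx hR0 _
    have hmem1 : fixTo (combBonds lo hi) 1 (updateFinset V Λ (expFibreChart Λ 1 e x)) ∈ boxTest lo hi σ := by
      by_contra hnot
      refine hR0 ?_
      show Gx (fixTo (combBonds lo hi) 1 V) *
          giF lo hi σ β Pw (fixTo (combBonds lo hi) 1 (updateFinset V Λ (expFibreChart Λ 1 e x))) = 0
      have h0 : giF lo hi σ β Pw (fixTo (combBonds lo hi) 1 (updateFinset V Λ (expFibreChart Λ 1 e x))) = 0 := by
        unfold giF; rw [indicator_of_notMem hnot, zero_mul]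
      rw [h0, mul_zero]
    have key := hden1 V x hx hmem1
    show Gx (fixTo (combBonds lo hi) 1 V) *
        giF lo hi σ β Pw (fixTo (combBonds lo hi) 1 (updateFinset V Λ (expFibreChart Λ 1 e x))) ≤
      ENNReal.ofReal (Real.exp (Bf * a)) * (Gx (fixTo (combBonds lo hi) 1 V) *
        giF lo hi σ β Pw (fixTo (combBonds lo hi) 1 (updateFinset V Λ (expFibreChart Λ 1 e (Real.exp (-a) • x)))))
    calc Gx (fixTo (combBonds lo hi) 1 V) *
          giF lo hi σ β Pw (fixTo (combBonds lo hi) 1 (updateFinset V Λ (expFibreChart Λ 1 e x)))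
        ≤ Gx (fixTo (combBonds lo hi) 1 V) * (ENNReal.ofReal (Real.exp (Bf * a)) *
          giF lo hi σ β Pw (fixTo (combBonds lo hi) 1 (updateFinset V Λ (expFibreChart Λ 1 e
            (Real.exp (-a) • x))))) := mul_le_mul' le_rfl key
      _ = _ := by rw [mul_left_comm]

end Main

end Summit.QuantumFields.BalabanUV.T4Continuum.ShellMeasureWilsonExterior
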